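import Mathlib.Topology.ContinuousMap.Bounded.ArzelaAscoli
import Mathlib.Topology.MetricSpace.Equicontinuity
import Mathlib.Topology.MetricSpace.ProperSpace
import Mathlib.Analysis.Normed.Group.Basic
import Mathlib.Analysis.SpecialFunctions.Pow.Continuity
import HarnessLib

/-!
# Seregin–Šverák 2009, §4: the diagonal Arzelà–Ascoli extraction (elementary lemmas)

Support file for the compactness step (iv) of G. Seregin, V. Šverák, *On Type I singularities
of the local axi-symmetric solutions of the Navier–Stokes equations*, Comm. PDE 34 (2009) =
arXiv:0804.1803, §4 (arXiv p. 11): "By the embedding theorem, sequence `u^k` is uniformly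
bounded in the parabolic Hölder space `C^{1/2}(Q̄(a/2))`. Hence, without loss of generality, one
may assume that `u^k → u` in `C^{1/4}(Q̄(a/2))`" — for every `a > 0`, i.e. along ONE diagonal
subsequence. Everything here is general topology, proved in full from Mathlib:

* `mem_of_continuousOn_of_subset_closure`, `dist_le_mul_rpow_of_subset_closure`: closed
  conditions (membership in a closed set, a Hölder modulus) satisfied on `D` by a map continuous
  on `S`, `D ⊆ S ⊆ closure D`, hold on `S` (used to carry the bounds of §4 from the open
  cylinders `Q(R)` to their top slices `s = 0`);
* `exists_strictMono_tendstoUniformlyOn`: given compact sets `T n` and maps `V k` which, for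
  each `n` and all large `k`, are continuous on `T n`, bounded by `1` and share a Hölder modulus
  there, some subsequence converges uniformly on every `T n` to one map `W`
  (Arzelà–Ascoli on each `T n`, Mathlib's `BoundedContinuousFunction.arzela_ascoli₂`, and a
  diagonal extraction realised as sequential compactness of the product of the compact sets of
  the `T n →ᵇ Y`).

## References

* G. Seregin, V. Šverák, Comm. PDE 34 (2009), arXiv:0804.1803, §4 p. 11. [`SereginSverak2009`]
-/

noncomputable section

open Set Function Filter Topology Metric
open scoped BoundedContinuousFunction NNReal

namespace Literature.Analysis.FluidPDE

namespace SereginSverak2009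

/-! ### Closed conditions pass to the closure along continuous maps -/

/-- If `f` is continuous on `S`, `D ⊆ S ⊆ closure D`, and `f` takes values in the closed set `C`
on `D`, then it does so on all of `S`. [folklore] -/
theorem mem_of_continuousOn_of_subset_closure {X Y : Type*} [TopologicalSpace X]
    [TopologicalSpace Y] {f : X → Y} {S D : Set X} {C : Set Y} (hf : ContinuousOn f S)
    (hDS : D ⊆ S) (hSD : S ⊆ closure D) (hC : IsClosed C) (h : ∀ z ∈ D, f z ∈ C) :
    ∀ z ∈ S, f z ∈ C := by
  intro z hz
  have h1 : ContinuousWithinAt f D z := (hf z hz).mono hDS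
  have h2 : f z ∈ closure (f '' D) := h1.mem_closure_image (hSD hz)
  refine closure_minimal ?_ hC h2
  rintro _ ⟨w, hw, rfl⟩
  exact h w hw

/-- A Hölder-type modulus `dist (f z) (f z') ≤ K * dist z z' ^ α` (`0 < α`) valid on `D`
extends to every `S` with `D ⊆ S ⊆ closure D` on which `f` is continuous. [folklore] -/
theorem dist_le_mul_rpow_of_subset_closure {X Y : Type*} [PseudoMetricSpace X]
    [PseudoMetricSpace Y] {f : X → Y} {S D : Set X} (hf : ContinuousOn f S) (hDS : D ⊆ S)
    (hSD : S ⊆ closure D) {K α : ℝ} (hα : 0 < α)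
    (h : ∀ z ∈ D, ∀ z' ∈ D, dist (f z) (f z') ≤ K * dist z z' ^ α) :
    ∀ z ∈ S, ∀ z' ∈ S, dist (f z) (f z') ≤ K * dist z z' ^ α := by
  intro z hz z' hz'
  have hmem : (z, z') ∈ closure (D ×ˢ D) := by
    rw [closure_prod_eq]
    exact ⟨hSD hz, hSD hz'⟩
  have h1 : ContinuousWithinAt (fun q : X × X => f q.1) (S ×ˢ S) (z, z') :=
    ContinuousWithinAt.comp (f := Prod.fst) (hf z hz) continuousWithinAt_fst fun q hq => hq.1
  have h2 : ContinuousWithinAt (fun q : X × X => f q.2) (S ×ˢ S) (z, z') :=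
    ContinuousWithinAt.comp (f := Prod.snd) (hf z' hz') continuousWithinAt_snd fun q hq => hq.2
  have hF : ContinuousWithinAt (fun q : X × X => dist (f q.1) (f q.2)) (D ×ˢ D) (z, z') :=
    (ContinuousWithinAt.mono (Filter.Tendsto.dist h1 h2) (prod_mono hDS hDS))
  have hG : ContinuousWithinAt (fun q : X × X => K * dist q.1 q.2 ^ α) (D ×ˢ D) (z, z') := by
    have hc : Continuous (fun q : X × X => K * dist q.1 q.2 ^ α) :=
      continuous_const.mul (continuous_dist.rpow_const fun q => Or.inr hα.le)
    exact hc.continuousWithinAt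
  exact hF.closure_le hmem hG fun q hq => h q.1 hq.1 q.2 hq.2

/-! ### The diagonal Arzelà–Ascoli extraction -/

/-- **Diagonal Arzelà–Ascoli.** Let `T n` be compact subsets of a metric space and `V k` maps
into a proper normed group which, for each `n` and all large `k`, are continuous on `T n`,
bounded by `1` there, and share the modulus `dist (V k z) (V k z') ≤ K n * dist z z' ^ α n`
(`0 ≤ K n`, `0 < α n`). Then along some subsequence `φ` the maps `V (φ j)` converge uniformly on
every `T n` to a single map `W` (Seregin–Šverák 2009, §4: "sequence `u^k` is uniformly bounded
in the parabolic Hölder space … Hence, without loss of generality, one may assume that `u^k → u`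
in `C^{1/4}(Q̄(a/2))`", for every `a`). [folklore] -/
theorem exists_strictMono_tendstoUniformlyOn {X Y : Type*} [PseudoMetricSpace X]
    [NormedAddCommGroup Y] [ProperSpace Y] {T : ℕ → Set X} (hT : ∀ n, IsCompact (T n))
    {V : ℕ → X → Y} {K α : ℕ → ℝ} (hK : ∀ n, 0 ≤ K n) (hα : ∀ n, 0 < α n)
    (hV : ∀ n, ∀ᶠ k in atTop, ContinuousOn (V k) (T n) ∧ (∀ z ∈ T n, ‖V k z‖ ≤ 1) ∧
      ∀ z ∈ T n, ∀ z' ∈ T n, dist (V k z) (V k z') ≤ K n * dist z z' ^ α n) :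
    ∃ φ : ℕ → ℕ, StrictMono φ ∧ ∃ W : X → Y,
      ∀ n, TendstoUniformlyOn (fun j => V (φ j)) W atTop (T n) := by
  classical
  haveI : ∀ n, CompactSpace (T n) := fun n => isCompact_iff_compactSpace.1 (hT n)
  -- the compact sets of bounded continuous functions on the `T n` cut out by the bounds
  let S : ∀ n, Set (T n →ᵇ Y) := fun n =>
    {f | (∀ x, ‖f x‖ ≤ 1) ∧ ∀ x y, dist (f x) (f y) ≤ K n * dist x y ^ α n}
  have hS : ∀ n, IsCompact (S n) := by
    intro n
    refine BoundedContinuousFunction.arzela_ascoli₂ (closedBall (0 : Y) 1)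
      (isCompact_closedBall 0 1) (S n) ?_ (fun f x hf => mem_closedBall_zero_iff.2 (hf.1 x)) ?_
    · have h1 : IsClosed {f : T n →ᵇ Y | ∀ x, ‖f x‖ ≤ 1} := by
        have heq : {f : T n →ᵇ Y | ∀ x, ‖f x‖ ≤ 1} = ⋂ x, {f | ‖f x‖ ≤ 1} := by
          ext f
          simp
        rw [heq]
        exact isClosed_iInter fun x =>
          isClosed_le (continuous_eval_const x).norm continuous_const
      have h2 : IsClosed {f : T n →ᵇ Y | ∀ x y, dist (f x) (f y) ≤ K n * dist x y ^ α n} := by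
        have heq : {f : T n →ᵇ Y | ∀ x y, dist (f x) (f y) ≤ K n * dist x y ^ α n} =
            ⋂ x, ⋂ y, {f | dist (f x) (f y) ≤ K n * dist x y ^ α n} := by
          ext f
          simp
        rw [heq]
        exact isClosed_iInter fun x => isClosed_iInter fun y =>
          isClosed_le ((continuous_eval_const x).dist (continuous_eval_const y))
            continuous_const
      exact h1.inter h2
    · refine Metric.equicontinuous_of_continuity_modulus (fun d => K n * d ^ α n) ?_ _ ?_
      · have hc : Continuous fun d : ℝ => K n * d ^ α n :=
          continuous_const.mul (continuous_id.rpow_const fun d => Or.inr (hα n).le)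
        simpa [Real.zero_rpow (hα n).ne'] using hc.tendsto 0
      · rintro x y ⟨f, hf⟩
        exact hf.2 x y
  have hSpi : IsCompact (Set.pi univ S) := isCompact_univ_pi hS
  -- the bounds, and the restrictions of the `V k` to the `T n` as bounded continuous functions
  let P : ℕ → ℕ → Prop := fun n k => ContinuousOn (V k) (T n) ∧ (∀ z ∈ T n, ‖V k z‖ ≤ 1) ∧
    ∀ z ∈ T n, ∀ z' ∈ T n, dist (V k z) (V k z') ≤ K n * dist z z' ^ α n
  let F : ℕ → ∀ n, (T n →ᵇ Y) := fun k n =>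
    if h : P n k then BoundedContinuousFunction.mkOfCompact
      ⟨(T n).restrict (V k), continuousOn_iff_continuous_restrict.1 h.1⟩ else 0
  have hFP : ∀ k n, P n k → ∀ x : T n, F k n x = V k x := fun k n h x => by
    simp only [F, dif_pos h]
    rfl
  have hF : ∀ k, F k ∈ Set.pi univ S := by
    intro k n _
    by_cases h : P n k
    · refine ⟨fun x => ?_, fun x y => ?_⟩
      · rw [hFP k n h x]
        exact h.2.1 x x.2
      · rw [hFP k n h x, hFP k n h y]
        exact h.2.2 x x.2 y y.2
    · simp only [F, dif_neg h]
      refine ⟨fun x => by simp, fun x y => ?_⟩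
      simp only [BoundedContinuousFunction.coe_zero, Pi.zero_apply, dist_self]
      exact mul_nonneg (hK n) (Real.rpow_nonneg dist_nonneg _)
  -- one subsequence for all `n` at once: sequential compactness of the product
  obtain ⟨G, -, φ, hφ, hlim⟩ := hSpi.tendsto_subseq hF
  refine ⟨φ, hφ, ?_⟩
  have hn : ∀ n, TendstoUniformly (fun j => ⇑(F (φ j) n)) (⇑(G n)) atTop := fun n =>
    BoundedContinuousFunction.tendsto_iff_tendstoUniformly.1
      (((continuous_apply n).tendsto G).comp hlim)
  have hev : ∀ n, ∀ᶠ j in atTop, ∀ x : T n, F (φ j) n x = V (φ j) x := fun n => by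
    filter_upwards [hφ.tendsto_atTop.eventually (hV n)] with j hj
    exact hFP (φ j) n hj
  have hpt : ∀ m (z : X) (hz : z ∈ T m),
      Tendsto (fun j => V (φ j) z) atTop (𝓝 (G m ⟨z, hz⟩)) := fun m z hz => by
    refine ((hn m).tendsto_at ⟨z, hz⟩).congr' ?_
    filter_upwards [hev m] with j hj
    exact hj ⟨z, hz⟩
  -- the common limit
  let W : X → Y := fun z => if h : ∃ n, z ∈ T n then G (Nat.find h) ⟨z, Nat.find_spec h⟩ else 0
  refine ⟨W, fun n => ?_⟩
  have hW : ∀ z (hz : z ∈ T n), W z = G n ⟨z, hz⟩ := fun z hz => by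
    have hex : ∃ m, z ∈ T m := ⟨n, hz⟩
    simp only [W, dif_pos hex]
    exact tendsto_nhds_unique (hpt _ z _) (hpt n z hz)
  rw [tendstoUniformlyOn_iff_tendstoUniformly_comp_coe]
  have hWG : (W ∘ ((↑) : T n → X)) = ⇑(G n) := funext fun x => by
    simpa using hW x x.2
  rw [hWG, tendstoUniformly_congr (F' := fun j => ⇑(F (φ j) n))]
  · exact hn n
  · filter_upwards [hev n] with j hj
    exact funext fun x => (hj x).symm

end SereginSverak2009

end Literature.Analysis.FluidPDE
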